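import Literature.Computability.AlgebraicComplexity.BI17FundamentalInvariantTensors
import HarnessLib

/-!
# Bürgisser–Ikenmeyer 2017, §5.2: the Latin-cube count for `n = 2` (kernel evaluation)

Topic `Literature/Computability/AlgebraicComplexity` (val-lit cell, row BI17; board v13 menu item
"`BI2017_latinCube_2_4` n = 2 conjunct"). Theorems only: no definitions, no named facts.

Source: P. Bürgisser, C. Ikenmeyer, *Fundamental invariants of orbit closures*, J. Algebra 477
(2017) = arXiv:1511.02927 [BurgisserIkenmeyer2017], §5.2 (TeX L2449–2451; before Problem 5.23):
"Let `n` be even. Is the number of even Latin cubes of size `n` different from the number of odd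
Latin cubes of size `n`? We have verified this in the cases `n = 2` and `n = 4`." The tree's named
fact `BI2017_latinCube_2_4` (`BI17FundamentalInvariantTensors.lean`) is the conjunction
`latinCubeCount 2 ≠ 0 ∧ latinCubeCount 4 ≠ 0` of the two printed computer verifications. This file
PROVES the first conjunct by a kernel evaluation:

* `latinCubeCount_eq_sum_latinCubeSign` (any `n`): the signed count over Latin cubes is the sum of
  `sgn_x sgn_y sgn_z` over ALL labelings `[n]³ → [n²]` (the sign of a non-Latin labeling is `0`);
* `sum_latinCubeSign_eq_sum_perm` (any `n`): reparametrising a labeling by its `x`-slices, the sum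
  runs over the families of permutations `σ : [n] → 𝔖_{n²}` (the `x`-slices must be bijections);
* **`latinCubeCount_two : latinCubeCount 2 = 24`** (all `24` Latin cubes of size `2` are even — a
  Latin cube of size `2` is a bijection between the four antipodal pairs of cells of `[2]³` and the
  four symbols) and **`latinCubeCount_two_ne_zero`**, by `decide` over the `24² = 576` pairs of
  `x`-slice permutations.

The `n = 4` conjunct (a search over Latin cubes of size `4` with `16` symbols) is out of kernel
reach and stays open; nothing here bears on VP versus VNP, which is NOT proved.

## References

* [BurgisserIkenmeyer2017] P. Bürgisser, C. Ikenmeyer, arXiv:1511.02927, §5.2, Def. 5.21,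
  Prop. 5.22, Problem 5.23.

## Tree

`IsLatinCube`, `latinCubeSign`, `latinCubeCount`, `sliceSign`, `labelSignX/Y/Z`, `xSliceMap`,
`ySliceMap`, `zSliceMap` (`BI17FundamentalInvariantTensors`); `Kumar2015.seqSign`
(`KumarLatinRectangles`). Mathlib: `finProdFinEquiv`, `Fintype.decidableBijectiveFintype`,
`Equiv.ofBijective`, `Finset.sum_bij`.
-/

namespace Literature.Computability.AlgebraicComplexity

open Finset

/-! ### The count as a sum over all labelings, and over `x`-slice permutations -/

section General

variable (n : ℕ)

/-- `sliceSign` with the COMPUTABLE decidability instance for "all slices are bijections" (the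
definition uses the classical one; `Decidable` is a subsingleton): BI's "`sgn_x(α)` … the product
of the signs of the permutations of all `x`-slices … `:= 0`" if some slice is not a bijection.
[cite: BurgisserIkenmeyer2017, §5.1 (before eq. (5.5))] -/
theorem sliceSign_eq_ite (s : Fin n → Fin (n * n) → Fin (n * n)) :
    sliceSign n s =
      if ∀ ℓ, Function.Bijective (s ℓ) then ∏ ℓ, ((Kumar2015.seqSign (s ℓ) : ℤˣ) : ℤ) else 0 := by
  unfold sliceSign
  congr 1

/-- A family of slices that is not everywhere bijective has sign `0`.
[cite: BurgisserIkenmeyer2017, §5.1 (before eq. (5.5))] -/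
theorem sliceSign_eq_zero_of_not_forall_bijective {s : Fin n → Fin (n * n) → Fin (n * n)}
    (h : ¬ ∀ ℓ, Function.Bijective (s ℓ)) : sliceSign n s = 0 := by
  rw [sliceSign_eq_ite, if_neg h]

/-- **The signed Latin-cube count is the sum of `sgn_x sgn_y sgn_z` over all labelings**
`[n]³ → [n²]`: a labeling that is not a Latin cube has a non-bijective slice, hence sign `0`.
[cite: BurgisserIkenmeyer2017, Def. 5.21 and Prop. 5.22] -/
theorem latinCubeCount_eq_sum_latinCubeSign :
    latinCubeCount n = ∑ α : Fin n × Fin n × Fin n → Fin (n * n), latinCubeSign n α := by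
  classical
  unfold latinCubeCount
  rw [Finset.sum_filter]
  refine Finset.sum_congr rfl fun α _ => ?_
  -- the classical `if` of the definition versus any instance
  have key : ∀ (inst : Decidable (IsLatinCube n α)),
      @ite ℤ (IsLatinCube n α) inst (latinCubeSign n α) 0 = latinCubeSign n α := by
    intro inst
    by_cases h : IsLatinCube n α
    · rw [if_pos h]
    · rw [if_neg h]
      unfold IsLatinCube at h
      unfold latinCubeSign labelSignX labelSignY labelSignZ
      by_cases hx : ∀ ℓ, Function.Bijective (xSliceMap n α ℓ)
      · by_cases hy : ∀ ℓ, Function.Bijective (ySliceMap n α ℓ)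
        · have hz : ¬ ∀ ℓ, Function.Bijective (zSliceMap n α ℓ) := fun hz => h ⟨hx, hy, hz⟩
          rw [sliceSign_eq_zero_of_not_forall_bijective n hz, mul_zero]
        · rw [sliceSign_eq_zero_of_not_forall_bijective n hy, mul_zero, zero_mul]
      · rw [sliceSign_eq_zero_of_not_forall_bijective n hx, zero_mul, zero_mul]
  exact key _

/-- **Reparametrising a labeling by its `x`-slices**: `α ↦ (ℓ ↦ xSliceMap α ℓ)` is a bijection
`([n]³ → [n²]) ≃ ([n] → [n²] → [n²])` (inverse `s ↦ ((x,y,z) ↦ s x (y,z))`), under which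
`sgn_x(α) = ∏_ℓ sgn(s_ℓ)` vanishes unless every `s_ℓ` is a permutation; so the count is a sum over
`σ : [n] → 𝔖_{n²}` of `(∏_ℓ sgn σ_ℓ) · sgn_y · sgn_z` of the labeling `(x,y,z) ↦ σ_x(y,z)`.
[cite: BurgisserIkenmeyer2017, Def. 5.21] -/
theorem sum_latinCubeSign_eq_sum_perm :
    ∑ α : Fin n × Fin n × Fin n → Fin (n * n), latinCubeSign n α =
      ∑ σ : Fin n → Equiv.Perm (Fin (n * n)),
        (∏ ℓ, ((Kumar2015.seqSign (⇑(σ ℓ)) : ℤˣ) : ℤ)) *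
          labelSignY n (fun p => σ p.1 (finProdFinEquiv (p.2.1, p.2.2))) *
          labelSignZ n (fun p => σ p.1 (finProdFinEquiv (p.2.1, p.2.2))) := by
  classical
  -- the reparametrisation by `x`-slices
  let e : (Fin n × Fin n × Fin n → Fin (n * n)) ≃ (Fin n → Fin (n * n) → Fin (n * n)) :=
    { toFun := fun α => xSliceMap n α
      invFun := fun s p => s p.1 (finProdFinEquiv (p.2.1, p.2.2))
      left_inv := fun α => by
        funext p
        simp only [xSliceMap, Equiv.symm_apply_apply]
      right_inv := fun s => by
        funext ℓ q
        simp only [xSliceMap, Prod.mk.eta, Equiv.apply_symm_apply] }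
  have he : ∀ s : Fin n → Fin (n * n) → Fin (n * n),
      e.symm s = fun p => s p.1 (finProdFinEquiv (p.2.1, p.2.2)) := fun s => rfl
  have hx : ∀ s : Fin n → Fin (n * n) → Fin (n * n), xSliceMap n (e.symm s) = s :=
    fun s => e.apply_symm_apply s
  rw [← Equiv.sum_comp e.symm]
  -- `sgn_x` of the reparametrised labeling is `sliceSign s`
  have hterm : ∀ s : Fin n → Fin (n * n) → Fin (n * n),
      latinCubeSign n (e.symm s) =
        (if ∀ ℓ, Function.Bijective (s ℓ) then ∏ ℓ, ((Kumar2015.seqSign (s ℓ) : ℤˣ) : ℤ) else 0) *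
          labelSignY n (e.symm s) * labelSignZ n (e.symm s) := by
    intro s
    unfold latinCubeSign labelSignX
    rw [hx, sliceSign_eq_ite]
  simp_rw [hterm]
  -- restrict to the families of bijections and reindex them by permutations
  rw [← Finset.sum_filter_add_sum_filter_not Finset.univ
    (fun s : Fin n → Fin (n * n) → Fin (n * n) => ∀ ℓ, Function.Bijective (s ℓ))]
  have hzero : ∑ s ∈ Finset.univ.filter
      (fun s : Fin n → Fin (n * n) → Fin (n * n) => ¬ ∀ ℓ, Function.Bijective (s ℓ)),
      (if ∀ ℓ, Function.Bijective (s ℓ) then ∏ ℓ, ((Kumar2015.seqSign (s ℓ) : ℤˣ) : ℤ) else 0) *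
        labelSignY n (e.symm s) * labelSignZ n (e.symm s) = 0 := by
    refine Finset.sum_eq_zero fun s hs => ?_
    rw [Finset.mem_filter] at hs
    rw [if_neg hs.2, zero_mul, zero_mul]
  rw [hzero, add_zero]
  symm
  refine Finset.sum_bij (fun (σ : Fin n → Equiv.Perm (Fin (n * n))) _ => fun ℓ => ⇑(σ ℓ))
    ?_ ?_ ?_ ?_
  · intro σ _
    rw [Finset.mem_filter]
    exact ⟨Finset.mem_univ _, fun ℓ => (σ ℓ).bijective⟩
  · intro σ _ σ' _ h
    funext ℓ
    exact Equiv.ext (congr_fun (congr_fun h ℓ))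
  · intro s hs
    rw [Finset.mem_filter] at hs
    exact ⟨fun ℓ => Equiv.ofBijective (s ℓ) (hs.2 ℓ), Finset.mem_univ _, rfl⟩
  · intro σ _
    rw [if_pos fun ℓ => (σ ℓ).bijective, he]

/-- The count as a sum over `x`-slice permutations. [cite: BurgisserIkenmeyer2017, Def. 5.21] -/
theorem latinCubeCount_eq_sum_perm :
    latinCubeCount n =
      ∑ σ : Fin n → Equiv.Perm (Fin (n * n)),
        (∏ ℓ, ((Kumar2015.seqSign (⇑(σ ℓ)) : ℤˣ) : ℤ)) *
          labelSignY n (fun p => σ p.1 (finProdFinEquiv (p.2.1, p.2.2))) *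
          labelSignZ n (fun p => σ p.1 (finProdFinEquiv (p.2.1, p.2.2))) := by
  rw [latinCubeCount_eq_sum_latinCubeSign, sum_latinCubeSign_eq_sum_perm]

end General

/-! ### `n = 2`: kernel evaluation -/

/-- **BI 2017, §5.2, the case `n = 2` of the verification before Problem 5.23**: the number of
even Latin cubes of size `2` minus the number of odd ones is `24` (all `24` Latin cubes of size `2`
are even). Kernel evaluation (`decide`) of the sum over the `24² = 576` pairs of `x`-slice
permutations of `latinCubeCount_eq_sum_perm`. [cite: BurgisserIkenmeyer2017, §5.2 (before Problem 5.23)] -/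
theorem latinCubeCount_two : latinCubeCount 2 = 24 := by
  rw [latinCubeCount_eq_sum_perm]
  unfold labelSignY labelSignZ
  simp only [sliceSign_eq_ite]
  decide +kernel

/-- **BI 2017, §5.2: `latinCubeCount 2 ≠ 0`** — the `n = 2` conjunct of the named fact
`BI2017_latinCube_2_4`. [cite: BurgisserIkenmeyer2017, §5.2 (before Problem 5.23)] -/
theorem latinCubeCount_two_ne_zero : latinCubeCount 2 ≠ 0 := by
  rw [latinCubeCount_two]
  decide

/-- The `n = 2` half of `BI2017_latinCube_2_4`, in the shape of the fact's first conjunct.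
[cite: BurgisserIkenmeyer2017, §5.2 (before Problem 5.23)] -/
theorem BI2017_latinCube_2_4_left : latinCubeCount 2 ≠ 0 := latinCubeCount_two_ne_zero

end Literature.Computability.AlgebraicComplexity
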